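import Mathlib.RingTheory.Regular.RegularSequence
import HarnessLib

/-!
# Venture HSemireg — a regular pair on `N` is a regular pair on `Hom(M, N)`

The depth input of the EXCISION step of the cell `pub-hsemireg`'s structure theorems (CLEAN-FLAT
(S3⁺), THEOREM CC (S3♯), THEOREM CC-F of `widen/W1/CLEAN-COMPONENT-THEOREM-w1tw1.md`): the normal
sheaf `N_Y = 𝓗om(I/I², O_Y)` has depth `≥ 2` wherever `O_Y` has — Bruns–Herzog, Ex. 1.4.19:
`depth Hom_R(M, N) ≥ min(2, depth N)`. In the language of Mathlib's weakly regular sequences: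

* `isSMulRegular_linearMap` — if `x` is a non-zero-divisor on `N` then on `M →ₗ[R] N`;
* `exists_eq_smul_of_smul_eq_smul` — if moreover `y` is a non-zero-divisor on `N/xN`, then every
  `h : M →ₗ N` with `y • h = x • k` is divisible by `x` (pointwise `h m ∈ xN`, and division by the
  regular element `x` is linear);
* `isSMulRegular_quotSMulTop_linearMap` — hence `y` is a non-zero-divisor on `Hom(M,N)/x·Hom(M,N)`
  (which embeds in `Hom(M, N/xN)`);
* `isWeaklyRegular_linearMap_pair` — **an `N`-regular pair `[x, y]` is a `Hom(M, N)`-regular pair**.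

(The companion fact «syzygies of a regular sequence are Koszul», used next to this one in the cell
record, is already the Literature theorem `hasKoszulSyzygies_of_isWeaklyRegular` of
`Literature/RingTheory/Koszul/RegularSequenceFirstHomology.lean` and is not restated here.)

HONEST FRAMING. Elementary commutative algebra; Lean index of one sentence of the cell record (the
depth of a Hom module), used there for the normal sheaf of a subscheme that is `S₂` along its gluing
locus. No scheme, abelian variety or semiregularity map appears; nothing here says that HC, HC_CM or
HC_AV holds, and nothing here is a new case of anything.
-/

open scoped Pointwise

namespace Summit.Ventures.HSemireg

namespace HomDepth

universe u v w

variable {R : Type u} [CommRing R] {M : Type v} [AddCommGroup M] [Module R M]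
  {N : Type w} [AddCommGroup N] [Module R N]

/-- Membership in `x • P` (all of a module scaled by `x`) means divisibility by `x`. [folklore] -/
theorem mem_smul_top_iff {P : Type*} [AddCommGroup P] [Module R P] {x : R} {p : P} :
    p ∈ x • (⊤ : Submodule R P) ↔ ∃ q : P, x • q = p := by
  rw [Submodule.mem_smul_pointwise_iff_exists]
  simp

/-- A non-zero-divisor on `N` is a non-zero-divisor on `M →ₗ[R] N`. [cite: BrunsHerzog1998, Ex. 1.4.19] -/
theorem isSMulRegular_linearMap {x : R} (hx : IsSMulRegular N x) :
    IsSMulRegular (M →ₗ[R] N) x := by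
  refine IsSMulRegular.of_right_eq_zero_of_smul fun f hf => ?_
  ext m
  have hm : x • f m = 0 := by
    have := LinearMap.congr_fun hf m
    simpa using this
  exact hx.right_eq_zero_of_smul hm

/-- **Division by a regular element is linear.** If `x` is a non-zero-divisor on `N` and `y` a
non-zero-divisor on `N/xN`, then every `h : M →ₗ N` with `y • h = x • k` for some `k` is of the form
`x • h'`: pointwise `y • h m ∈ xN` forces `h m ∈ xN`, and `h' := x⁻¹ ∘ h` is linear because
multiplication by `x` is injective. [cite: BrunsHerzog1998, Ex. 1.4.19] -/
theorem exists_eq_smul_of_smul_eq_smul {x y : R} (hx : IsSMulRegular N x)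
    (hy : IsSMulRegular (QuotSMulTop x N) y) {h k : M →ₗ[R] N} (hk : y • h = x • k) :
    ∃ h' : M →ₗ[R] N, x • h' = h := by
  -- multiplication by `x` as an injective linear map, and `N ≃ xN`
  let L : N →ₗ[R] N := DistribSMul.toLinearMap R N x
  have hL : Function.Injective L := hx
  let e := LinearEquiv.ofInjective L hL
  -- every value of `h` is divisible by `x`
  have hmem : ∀ m : M, h m ∈ LinearMap.range L := by
    intro m
    have h1 : y • h m ∈ x • (⊤ : Submodule R N) := by
      refine mem_smul_top_iff.mpr ⟨k m, ?_⟩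
      have := LinearMap.congr_fun hk m
      simpa using this.symm
    have h2 : h m ∈ x • (⊤ : Submodule R N) := mem_of_isSMulRegular_quotient_of_smul_mem hy h1
    obtain ⟨q, hq⟩ := mem_smul_top_iff.mp h2
    exact ⟨q, hq⟩
  refine ⟨e.symm.toLinearMap ∘ₗ h.codRestrict (LinearMap.range L) hmem, ?_⟩
  ext m
  have key : ∀ z : LinearMap.range L, x • (e.symm z) = (z : N) := by
    intro z
    have h1 := congrArg Subtype.val (e.apply_symm_apply z)
    rw [LinearEquiv.ofInjective_apply] at h1
    exact h1
  simp only [LinearMap.smul_apply, LinearMap.coe_comp, LinearEquiv.coe_coe, Function.comp_apply]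
  rw [key]
  rfl

/-- If `[x, y]` is weakly regular on `N` (`x` regular on `N`, `y` regular on `N/xN`) then `y` is
regular on `Hom(M,N)/x·Hom(M,N)`. [cite: BrunsHerzog1998, Ex. 1.4.19] -/
theorem isSMulRegular_quotSMulTop_linearMap {x y : R} (hx : IsSMulRegular N x)
    (hy : IsSMulRegular (QuotSMulTop x N) y) :
    IsSMulRegular (QuotSMulTop x (M →ₗ[R] N)) y := by
  rw [isSMulRegular_quotient_iff_mem_of_smul_mem]
  intro h hyh
  obtain ⟨k, hk⟩ := mem_smul_top_iff.mp hyh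
  obtain ⟨h', hh'⟩ := exists_eq_smul_of_smul_eq_smul (M := M) hx hy hk.symm
  exact mem_smul_top_iff.mpr ⟨h', hh'⟩

/-- **A regular pair on `N` is a regular pair on `Hom(M, N)`** (`depth Hom(M,N) ≥ min(2, depth N)`
in its two-element form). [cite: BrunsHerzog1998, Ex. 1.4.19] -/
theorem isWeaklyRegular_linearMap_pair {x y : R}
    (h : RingTheory.Sequence.IsWeaklyRegular N [x, y]) :
    RingTheory.Sequence.IsWeaklyRegular (M →ₗ[R] N) [x, y] := by
  rw [RingTheory.Sequence.isWeaklyRegular_cons_iff,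
    RingTheory.Sequence.isWeaklyRegular_singleton_iff] at h ⊢
  exact ⟨isSMulRegular_linearMap h.1, isSMulRegular_quotSMulTop_linearMap h.1 h.2⟩

end HomDepth

end Summit.Ventures.HSemireg
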